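import Summits.BirchSwinnertonDyer.BirchSwinnertonDyer.Theorems.ClassRecordThreeEulerHalvesAtThreeHybridInert
import HarnessLib

/-!
# Route `ClassRecordThree` (rung K2@3), crux 5 `EulerHalvesAtThree` (item stmt-BirchSwinnertonDyer-19109, shared by
# `KolyvaginRoadThree`): the hybrid reading cut by the carrier-inert Shimura road, with the IMC-grade RESIDUAL NAMED BY
# SHAPE (cell `bsd-stepL`, seat `bsd-stepL-tam3-p1` g9, owner of the line; RULING 31 (D); `--supports stmt-BirchSwinnertonDyer-19109 --as helper`)

HONEST FRAMING: theorems only (no definition, no named fact, no `sorry`); CONDITIONAL on cited Literature facts taken BY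
NAME and on OPEN inputs stated inline; nothing is asserted about any curve; item 19109 stays open; BSD is not advanced; no
census word, tier or label moves (T7).

Sibling `…EulerHalvesAtThreeHybridInert.lean` §3 asks the IMC-grade binder CoS₃ on the multi-carrier curves that are «not
inert-servable» (no (ram) witness with SHAPE and admissible `S ∋ 3`). THIS FILE precomposes it with the sibling's §2
(`inertServable_of_ram_of_not_shapeGamma_of_atMostOneCarrier`, the admissible set CONSTRUCTED) so that the residual is
named by three decidable SHAPES of the curve: no (ram) witness, OR an additive (T2γ) carrier, OR two distinct split
multiplicative carriers `q₁ ≠ q₂`, both `≠ 3` — the statement a skeleton stub can carry verbatim. Census pointer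
(EVIDENCE, T7; corner3-p2 g3 `adm_t2p.tsv`): among the 568 TRUE-OPEN (T2′)@3 frames the multi-carrier ones meeting the
residual shape are exactly the 178 (α)∧ram frames with ONE (T2γ) place (each missing exactly one unit of Tamagawa depth).
References: [WZhang2014] Lemma 10.1; [PastenShimura2024] Lemmas 6.15, 6.18; [JetchevSkinnerWan2017] §7.4.2; tree: the
sibling, p540392, p550099.
-/

noncomputable section

open scoped Classical NumberField

namespace Summit.BirchSwinnertonDyer.Rank1Residual.X11b.Three.Koly

open WeierstrassCurve NumberField IsDedekindDomain Field Literature.NumberTheory.EllipticCurves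
  Literature.NumberTheory.EllipticCurves.ModularForms Literature.NumberTheory.GaloisCohomology
  Literature.NumberTheory.EllipticCurves.Rank1Residual Literature.NumberTheory.EllipticCurves.Rank1Residual.Typed
  Literature.NumberTheory.QuadraticFields.Quadratic Literature.NumberTheory.EllipticCurves.BarriosEtAl2025
  Literature.NumberTheory.Automorphic CongruenceSubgroup
  Summit.BirchSwinnertonDyer.Rank1Residual Summit.BirchSwinnertonDyer.Rank1Residual.X11b
  Summit.BirchSwinnertonDyer.Rank1Residual.X11b.AcSelmer
  Summit.BirchSwinnertonDyer.BirchSwinnertonDyer.Theorems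

section ShapeResidual

variable
  (hGZ : ∀ (N : ℕ) [NeZero N] (W : WeierstrassCurve ℚ) (K : Type) [Field K] [NumberField K],
    gross_zagier N W K)
  (hKo : ∀ (N : ℕ) [NeZero N] (W : WeierstrassCurve ℚ) (K : Type) [Field K] [NumberField K],
    kolyvagin N W K)
  (hSk : Skinner2016.thmC_padicValRat_bsd_rank_zero)
  (hGZK : rank_eq_analyticRank_of_analyticRank_le_one) (hmod : hasEntireLFunction_rat)
  (hnf : exists_isNewformOf) (hHL : HoffsteinLuo1997_exists_twist_L_one_ne_zero)
  (hMaz : mazur_not_dvd_maninConstant_of_odd)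
  (hrec : ∀ (N : ℕ) [NeZero N] (W : WeierstrassCurve ℚ) (K : Type) [Field K] [NumberField K],
    heegnerPointOfConductor_one_galoisConj N W K)
  (hD36 : ∀ (N : ℕ) [NeZero N] (W : WeierstrassCurve ℚ) (K : Type) [Field K] [NumberField K],
    phi_heegnerTau_mem_singularModuliField N W K)
  (hMcU : McCallum1991_padicValNat_card_sha_primary_add_le_of_globalDivisibility)
  (hPT : ∀ (K : Type) [Field K] [NumberField K], poitouTate_selmerStructure_duality K)
  (hPT2 : ∀ (K : Type) [Field K] [NumberField K], poitouTate_sha_tateDual K)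
  (hFH : friedbergHoffstein_exists_twist_ne_zero_inertAt)
  (hBR : localTamagawaNumber_quadraticTwist_two_mem_of_goodReduction)
  (hJL : nonempty_shimuraParametrizationData)
  (hCO : PastenShimura2024_componentOrders)
  -- OPEN INPUT 1 (classical, reading-shaped): tam3's `JetchevMaxHL` — Jetchev 2008 Thm. 1.4 MAX form at 3 ∥ N, verbatim
  (hJmax : ∀ (W : WeierstrassCurve ℚ) [W.IsElliptic] [W.IsGloballyMinimal] [NeZero (W.conductorNorm ℤ)]
    (K : Type) [Field K] [NumberField K]
    (Dt : ModularParametrizationData W (W.conductorNorm ℤ)) (β : ℤ) (ι : K →+* ℂ),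
    W.analyticRank = 1 → W.HasMultiplicativeReductionAtPrime 3 → Surj W 3 →
    IsImaginaryQuadratic K → SatisfiesHeegnerHypothesis (W.conductorNorm ℤ) K →
    Odd (NumberField.discr K) → (W.quadraticTwist (NumberField.discr K : ℚ)).entireLFunction 1 ≠ 0 →
    (4 * (W.conductorNorm ℤ : ℤ)) ∣ β ^ 2 - NumberField.discr K → ¬ (3 : ℤ) ∣ Dt.c →
    ∀ (v : HeightOneSpectrum (𝓞 ℚ)) (s : ℕ), s ≤ padicValNat 3 (W.tamagawaNumberAt v) →
      ∀ (n : ℕ) (d : KolyvaginHeegnerData Dt β ι n), Squarefree n →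
        (∀ ℓ ∈ n.primeFactors, Zhang2014.IsKolyvaginPrime (W.conductorNorm ℤ) W K 3 ℓ ∧
          s ≤ Zhang2014.kolyvaginIndex W 3 ℓ) → PDiv d 3 s)
  -- OPEN INPUT 2a (classical-Kolyvagin-grade reading at the inert place, image slice `Surj`): the inert display
  (hDisp : ∀ (V : WeierstrassCurve ℚ) [V.IsElliptic] [V.IsGloballyMinimal], ClassX11b V 3 → Surj V 3 →
    ∀ (N : ℕ) [NeZero N] (K : Type) [Field K] [NumberField K] (S : Finset ℕ)
    (Dt : ModularParametrizationData V N)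
    (X : ShimuraCurveData (∏ q ∈ S, q) (N / ∏ q ∈ S, q))
    (W' : WeierstrassCurve ℚ) [W'.IsElliptic] (P₀ : ShimuraParametrizationData X W'),
    V.conductorNorm ℤ = N → IsImaginaryQuadratic K → Even S.card →
    (∀ ℓ ∈ S, ℓ.Prime ∧ ℓ ∣ N ∧ ¬ ℓ ^ 2 ∣ N ∧
      ((Ideal.span {(ℓ : ℤ)}).primesOver (𝓞 K)).ncard = 1 ∧ ¬ (ℓ : ℤ) ∣ NumberField.discr K) →
    (∀ ℓ : ℕ, ℓ.Prime → ℓ ∣ N → ℓ ∉ S → ((Ideal.span {(ℓ : ℤ)}).primesOver (𝓞 K)).ncard = 2) →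
    3 ∈ S → ¬ (3 : ℤ) ∣ Dt.c → P₀.IsMinimalFor V →
    ∃ (P : (V.baseChange K).toAffine.Point) (degS : ℕ), 0 < degS ∧
      padicValNat 3 degS = padicValNat 3 P₀.deg ∧
      LDerivEK V K =
        8 * (Real.pi : ℂ) ^ 2 * peterssonProduct (Gamma0 N) 2 Dt.f Dt.f /
            ((((Units.torsionOrder K : ℝ) / 2) ^ 2 * √|(NumberField.discr K : ℝ)| : ℝ) : ℂ) *
          ((P.canonicalHeight : ℂ) / (degS : ℂ)) ∧
      (¬ IsOfFinAddOrder P →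
        Nat.card (AddCommGroup.primaryComponent (V.baseChange K).sha 3) ≤
          3 ^ (2 * padicValNat 3 (AddSubgroup.zmultiples P).index)))
  -- OPEN INPUT 3: TL₃ (derived from 19064@3 in the registered skeleton)
  (hTL : ∀ (V : WeierstrassCurve ℚ) [V.IsElliptic] [V.IsGloballyMinimal],
    V.HasMultiplicativeReductionAtPrime 3 → V.HasIrreducibleModPGaloisRep 3 →
    V.entireLFunction 1 ≠ 0 → Finite V.sha →
    ∃ q : ℚ, V.entireLFunction 1 / (V.realPeriodRat : ℂ) = (q : ℂ) ∧
      padicValRat 3 q ≤ (padicValNat 3 V.shaOrder : ℤ) + padicValNat 3 V.tamagawaProduct -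
        2 * padicValNat 3 V.torsionOrder)

include hGZ hKo hSk hGZK hmod hnf hHL hMaz hrec hD36 hMcU hPT hPT2 hFH hBR hJL hCO hJmax hDisp hTL

/-- **Item 19109 BY NAME with the IMC-grade residual asked only OFF THE INERT ROAD BY SHAPE**: CoS₃ on multi-carrier
X11b@3 curves that have no (ram) witness, OR an additive (T2γ) carrier, OR two distinct split multiplicative carriers
`q₁ ≠ q₂`, both `≠ 3` (OPEN INPUT 2b′ `hcoShape`) — the sibling's §3 precomposed with its §2 (the admissible set
CONSTRUCTED class-wide). On the census of record (EVIDENCE, T7) the TRUE-OPEN frames meeting the residual hypothesis are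
exactly the 178 (α)∧ram frames with ONE (T2γ) place (no multi-carrier frame lacks a witness or has two carriers `≠ 3`). CONDITIONAL;
the item does NOT close by this theorem; nothing booked. [cite: WZhang2014, Lemma 10.1]
[cite: PastenShimura2024, Lemmas 6.15 and 6.18] [cite: JetchevSkinnerWan2017, §7.4.2 (p. 31)] -/
theorem classRecordThree_eulerHalvesAtThree_of_jetchevMaxHL_of_inertDisplay_of_coStepLShapeResidual_of_twistLower
    (hcoShape : ∀ (W : WeierstrassCurve ℚ) [W.IsElliptic] [W.IsGloballyMinimal],
      (∀ v : HeightOneSpectrum (𝓞 ℚ),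
        padicValNat 3 (W.tamagawaNumberAt v) < padicValNat 3 W.tamagawaProduct) →
      (¬ Ram W 3 ∨ ShapeGamma W ∨
        ∃ (q₁ q₂ : ℕ) (_ : Fact q₁.Prime) (_ : Fact q₂.Prime), q₁ ≠ q₂ ∧ q₁ ≠ 3 ∧ q₂ ≠ 3 ∧
          W.HasSplitMultiplicativeReductionAtPrime q₁ ∧ 3 ∣ padicValInt q₁ W.minimalDiscriminantInt ∧
          W.HasSplitMultiplicativeReductionAtPrime q₂ ∧ 3 ∣ padicValInt q₂ W.minimalDiscriminantInt) →
      ∀ (N : ℕ) [NeZero N] (K : Type) [Field K] [NumberField K]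
        (Dt : ModularParametrizationData W N) (H : HeegnerDatum N (NumberField.discr K)) (ι : K →+* ℂ)
        (P : (W.baseChange K).toAffine.Point),
        ClassX11b W 3 → Surj W 3 → W.conductorNorm ℤ = N → IsImaginaryQuadratic K →
        Odd (NumberField.discr K) → SatisfiesHeegnerHypothesis N K →
        (W.quadraticTwist (NumberField.discr K : ℚ)).entireLFunction 1 ≠ 0 →
        WeierstrassCurve.Affine.Point.map ι.toRatAlgHom P = heegnerPointComplex Dt H →
        ¬ (3 : ℤ) ∣ Dt.c → ¬ IsOfFinAddOrder P →
        ∀ (κ : ZpExtension K 3), κ.IsAnticyclotomic →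
          ∀ (γ : Field.absoluteGaloisGroup K) [Fact (κ.IsTopGenerator γ)]
            (𝔭 : HeightOneSpectrum (𝓞 K)) (h𝔭 : ((3 : ℕ) : 𝓞 K) ∈ 𝔭.asIdeal)
            (he : 𝔭.asIdeal.ramificationIdx (𝓞 ℚ) = 1) (hf : 𝔭.asIdeal.inertiaDeg (𝓞 ℚ) = 1),
            IMCUpperWaldspurgerOnTreeAt 3 κ 𝔭 γ (embAt K 3 𝔭 h𝔭 he hf) P) :
    Summit.BirchSwinnertonDyer.BirchSwinnertonDyer.Theses.ClassRecordThree.EulerHalvesAtThree := by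
  refine classRecordThree_eulerHalvesAtThree_of_jetchevMaxHL_of_inertDisplay_of_coStepLResidual_of_twistLower hGZ
    hKo hSk hGZK hmod hnf hHL hMaz hrec hD36 hMcU hPT hPT2 hFH hBR hJL hCO hJmax hDisp hTL ?_
  intro W _ _ hmulti hns N _ K _ _ Dt H ι P hX
  refine hcoShape W hmulti ?_ N K Dt H ι P hX
  by_cases hram : Ram W 3
  · by_cases hγ : ShapeGamma W
    · exact Or.inr (Or.inl hγ)
    · refine Or.inr (Or.inr ?_)
      by_contra h2
      exact hns (inertServable_of_ram_of_not_shapeGamma_of_atMostOneCarrier W hX hram hγ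
        (fun q₁ q₂ _ _ h13 h23 hs1 hv1 hs2 hv2 ↦ by
          by_contra hne
          exact h2 ⟨q₁, q₂, ‹_›, ‹_›, hne, h13, h23, hs1, hv1, hs2, hv2⟩))
  · exact Or.inl hram

/-- **The `KolyvaginRoadThree` twin** (same statement, same inputs). [folklore] -/
theorem kolyvaginRoadThree_eulerHalvesAtThree_of_jetchevMaxHL_of_inertDisplay_of_coStepLShapeResidual_of_twistLower
    (hcoShape : ∀ (W : WeierstrassCurve ℚ) [W.IsElliptic] [W.IsGloballyMinimal],
      (∀ v : HeightOneSpectrum (𝓞 ℚ),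
        padicValNat 3 (W.tamagawaNumberAt v) < padicValNat 3 W.tamagawaProduct) →
      (¬ Ram W 3 ∨ ShapeGamma W ∨
        ∃ (q₁ q₂ : ℕ) (_ : Fact q₁.Prime) (_ : Fact q₂.Prime), q₁ ≠ q₂ ∧ q₁ ≠ 3 ∧ q₂ ≠ 3 ∧
          W.HasSplitMultiplicativeReductionAtPrime q₁ ∧ 3 ∣ padicValInt q₁ W.minimalDiscriminantInt ∧
          W.HasSplitMultiplicativeReductionAtPrime q₂ ∧ 3 ∣ padicValInt q₂ W.minimalDiscriminantInt) →
      ∀ (N : ℕ) [NeZero N] (K : Type) [Field K] [NumberField K]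
        (Dt : ModularParametrizationData W N) (H : HeegnerDatum N (NumberField.discr K)) (ι : K →+* ℂ)
        (P : (W.baseChange K).toAffine.Point),
        ClassX11b W 3 → Surj W 3 → W.conductorNorm ℤ = N → IsImaginaryQuadratic K →
        Odd (NumberField.discr K) → SatisfiesHeegnerHypothesis N K →
        (W.quadraticTwist (NumberField.discr K : ℚ)).entireLFunction 1 ≠ 0 →
        WeierstrassCurve.Affine.Point.map ι.toRatAlgHom P = heegnerPointComplex Dt H →
        ¬ (3 : ℤ) ∣ Dt.c → ¬ IsOfFinAddOrder P →
        ∀ (κ : ZpExtension K 3), κ.IsAnticyclotomic →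
          ∀ (γ : Field.absoluteGaloisGroup K) [Fact (κ.IsTopGenerator γ)]
            (𝔭 : HeightOneSpectrum (𝓞 K)) (h𝔭 : ((3 : ℕ) : 𝓞 K) ∈ 𝔭.asIdeal)
            (he : 𝔭.asIdeal.ramificationIdx (𝓞 ℚ) = 1) (hf : 𝔭.asIdeal.inertiaDeg (𝓞 ℚ) = 1),
            IMCUpperWaldspurgerOnTreeAt 3 κ 𝔭 γ (embAt K 3 𝔭 h𝔭 he hf) P) :
    Summit.BirchSwinnertonDyer.BirchSwinnertonDyer.Theses.KolyvaginRoadThree.EulerHalvesAtThree :=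
  classRecordThree_eulerHalvesAtThree_of_jetchevMaxHL_of_inertDisplay_of_coStepLShapeResidual_of_twistLower hGZ hKo
    hSk hGZK hmod hnf hHL hMaz hrec hD36 hMcU hPT hPT2 hFH hBR hJL hCO hJmax hDisp hTL hcoShape

end ShapeResidual

end Summit.BirchSwinnertonDyer.Rank1Residual.X11b.Three.Koly

end
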